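import Mathlib
import Summits.Ventures.Crystal3D.Theorems.StickyWulffConstantTextureLiminfTentHatDefs
import HarnessLib

/-!
# The tent certificate for fcc grains — DEFINITIONS, II: cell kinds, the complex of a site set, broken bonds near a set (eng g8)

Route `StickyWulffConstant` (`Summits/Ventures/Crystal3D`, cell `crystal3d-full`), support toward the crux
`TextureLiminf` (stmt-Ventures-19483), FREE half (tent certificate, TexShadow v6.1).  Companion of
`…TentHatDefs.lean`:
* `labelOf p κ` — the label of the cell of kind `κ : Bool ⊕ (Fin 3 → Bool)` anchored at the site `p`
  (`inl true` = up-tetrahedron `T⁺(p)`, `inl false` = down-tetrahedron `T⁻(p)`, `inr s` = the corner of the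
  octahedron `O(p)` pointing in the directions `s`);
* `labelsOf X` — the finite complex carrying the tent of `X`: all cells anchored at a site of `idx X`
  (the anchors of cells with an occupied vertex, as in `…TentTables.lean`);
* `brokenNear X U` — the number of ordered broken bonds `(x, x + δ)` (`x ∈ X`, `δ` a nearest-neighbour
  offset, `x + δ ∉ X`) whose occupied end lies within distance `√2` (one cell diameter) of the set `U` —
  the local currency of ROUTE.md §71.8 / the planner's `brokenNearIn`, in the cubic coefficient frame.
WHAT THIS IS NOT: statements or proofs; F-C1 not moved.
-/

noncomputable section

namespace Summit.Ventures.Crystal3D.TentCertificate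

open Finset Summit.Ventures.Crystal3D MeasureTheory
open Literature.Geometry.DiscreteGeometry (intVec)

/-- The label of the cell of kind `κ` anchored at `p`: `inl true ↦ T⁺(p)`, `inl false ↦ T⁻(p)`,
`inr s ↦` the corner `s` of `O(p)`. -/
def labelOf (p : Site) : Bool ⊕ (Fin 3 → Bool) → (Fin 3 → ℤ) × (Fin 4 → ℤ) :=
  Sum.elim (fun b => if b then labelUp p else labelDn p) (labelCorner p)

/-- The complex of a finite site set: the labels of all cells anchored at a site of `idx X`. -/
def labelsOf (X : Finset Site) : Finset ((Fin 3 → ℤ) × (Fin 4 → ℤ)) :=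
  (idx X ×ˢ (univ : Finset (Bool ⊕ (Fin 3 → Bool)))).image (fun q => labelOf q.1 q.2)

/-- Ordered broken bonds of `X` near `U`: pairs `(x, δ)` with `x ∈ X`, `δ ∈ fccOffsets`, `x + δ ∉ X` and
`infDist (site x) U ≤ √2` (positions `site x = (√2)⁻¹ • intVec (fccPoint x)`). -/
def brokenNear (X : Finset Site) (U : Set (EuclideanSpace ℝ (Fin 3))) : ℕ :=
  {q : Site × Site | q.1 ∈ X ∧ q.2 ∈ fccOffsets ∧ q.1 + q.2 ∉ X ∧
    Metric.infDist ((Real.sqrt 2)⁻¹ • intVec (fccPoint q.1)) U ≤ Real.sqrt 2}.ncard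

end Summit.Ventures.Crystal3D.TentCertificate

end
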